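import Literature.AlgebraicGeometry.HodgeTheory.SemiregularReducedObstructions
import Literature.AlgebraicGeometry.HodgeTheory.SemiregularSheafDeformationsUnobstructed
import Literature.AlgebraicGeometry.HodgeTheory.AlgebraicClassesHodgeTypeHolds
import Literature.AlgebraicGeometry.HodgeTheory.IsoTransport
import Literature.AlgebraicGeometry.Motives.CurveNet
import Mathlib.CategoryTheory.Limits.Shapes.Pullback.Iso
import HarnessLib

/-!
# Pridham 2024 at the constant family ⟹ Buchweitz–Flenner 2003, Thm. 7.3 (smoothness clause)

Family `hodge`, layer `Literature/AlgebraicGeometry/HodgeTheory`. PROVED BRIDGE between two named facts of the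
tree, NO new fact (D-0026): the relative fact `Pridham2024_ISemiregular_liftsOverHodgeLocus_model`
([Pridham2024Semiregularity, Cor. 2.25 with Rem. 2.27, Rem. 2.21, Lemma 1.8]: an `I`-semiregular vector bundle on a
fibre of a smooth projective family over a smooth base lifts over every Artinian point of the Hodge locus of its Chern
character) IMPLIES, at the CONSTANT family `X → Spec ℂ`, the absolute fact
`BuchweitzFlenner2003_semiregularSheaf_deformationsUnobstructed` ([BuchweitzFlenner2003, Thm. 7.3], smoothness clause
«if `σ` is injective then `S` is smooth», vector-bundle infinitesimal form; sibling file
`SemiregularSheafDeformationsUnobstructed.lean`, whose faithfulness sheet records this instantiation as a TODO). This is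
the sentence printed in [Pridham2024Semiregularity, p. 3 L1–3]: «if the family `X` is constant over `A` (i.e.,
`X ≃ X_0 × Spec A`), then the condition `ch_p(ℱ) ∈ F^p` is automatically satisfied and the obstruction `o(ℱ)` always maps
to zero (Remark 2.23)» — here for FULL `σ` (`I = Set.univ`) and `ℱ` finite locally free, the generality of both typed
facts. Together with `BuchweitzFlenner2003_semiregularSheaf_deformationsUnobstructed_of_annihilates` (the 2023 route,
[BandieraLepriManetti2023, Cor. 1.1]) the tree now holds BOTH modern proofs of BF Thm. 7.3's smoothness clause as
implications between facts typed BY NAME. Typed for the literature-typing tranche LT-H1 «semiregularity consumers»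
(director-hodge g4, 2026-08-26). Nothing here asserts HC ∕ HC_AV ∕ any Weil-class statement.

## The instantiation (what is proved, and from what)

Given `X` smooth projective of dimension `n` over `ℂ` and the BF telescope (a principal small surjection `A ↠ B`,
constant deformations `X_A ⊇ X_B ⊇ X` as pullback squares of `X → Spec ℂ` along `Spec A → Spec ℂ`, `Spec B → Spec A`,
`Spec ℂ → Spec B`, a vector bundle `F` on `X_B` with `σ` injective on `j^*F`), Pridham's fact is applied to:
* the constant family `π : X ⟶ Spec ℂ` in `SchemeOver ℂ` (`Over.homMk X.hom`), which is a smooth projective family of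
  relative dimension `n` (`IsSmoothProjectiveFamily`): smooth of relative dimension `n` = the hypothesis on `X`; proper
  by the tree's theorem `IsSmoothProjective.isProper_holds` ([Hartshorne1977, II.4.9]); every fibre over a `ℂ`-point
  `s` of `Spec ℂ` is `X` itself up to the isomorphism `pullback.fst X.hom s.left` (`s.left` is an isomorphism, the
  `ℂ`-points of `Spec ℂ` over `ℂ` being the identity alone), so smooth projective (`IsSmoothProjective.of_iso`); the
  base `Spec ℂ` is smooth over itself (`𝟙` is an open immersion);
* `U = S(ℂ)` (one point), which is cohomologically locally trivial BY RESTRICTION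
  (`isCohomologicallyLocallyTrivialOn_univ_of_subsingleton`: the tube over `U` is `X(ℂ)` and restriction to the fibre
  is pull-back along the homeomorphism `X_s(ℂ) ≅ X(ℂ)`, bijective on `H^j`) — the degenerate case of
  [VoisinHodgeI2002, §9.2.1];
* the model `e : X ≅ X_{s₀}` inverse to the fibre inclusion, `E₀ := j^*F`, `I := Set.univ`;
* the HODGE hypothesis «the transports of `ch_p(E₀)` are of type `(p, p)` on `U`»: transport of the restriction of a
  global class is restriction (`transportFun_map_fiberι`, [VoisinHodgeII2003, §3.1.2]), Hodge types transport along
  isomorphisms (`isOfHodgeType_map_iff_of_iso`), and `ch_p` of a vector bundle on a smooth projective `X` is ALGEBRAIC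
  (`ChernCharacterBetti.ch_mem_algebraicClasses`, [Fulton1998, §15.1, Prop. 19.1.2]) hence of type `(p, p)` — the tree's
  THEOREM `isOfHodgeType_of_mem_algebraicClasses_of_isSmoothProjective` ([VoisinHodgeI2002, Prop. 11.20]); this is
  Pridham's «automatically satisfied»;
* the Artinian point `a : Spec A → Spec ℂ` (structure map), centred at `s₀` because `ρ ∘ f` is a `ℂ`-algebra map.
The conclusion `LiftsAlong i F` is then BF's. Relies on: the two facts named in the statement only (and a Chern character
theory `C : ChernCharacterBetti`, the parameter Pridham's fact is stated over); no `sorry`, standard axioms.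

## References

* [Pridham2024Semiregularity] J. P. Pridham, Forum Math. Sigma 12 (2024) e126, Cor. 2.25, Rem. 2.23, Rem. 2.27, p. 3 L1–3.
* [BuchweitzFlenner2003] R.-O. Buchweitz, H. Flenner, Compositio Math. 137 (2003), Thm. 7.3.
* [BandieraLepriManetti2023] Adv. Math. 435 (2023) 109358, Cor. 1.1 (the other route, sibling file).
* [VoisinHodgeI2002] §9.2.1, Prop. 11.20; [VoisinHodgeII2003] §3.1.2. [Fulton1998] §15.1, Prop. 19.1.2.
* [Hartshorne1977] II.4.9 (projective ⟹ proper).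
-/

noncomputable section

open CategoryTheory CategoryTheory.Limits AlgebraicGeometry
open _root_.Topology _root_.Filter

namespace Literature.AlgebraicGeometry.HodgeTheory

open Literature.AlgebraicGeometry.Deformation Literature.AlgebraicGeometry.Modules
  Literature.AlgebraicGeometry.Motives Literature.AlgebraicTopology.SingularHomology

/-! ### The base point `Spec ℂ` over `ℂ` -/

/-- `Spec` of the structure map `ℂ → ℂ` is the identity. [folklore] -/
private theorem spec_map_algebraMap_complex_self :
    Spec.map (CommRingCat.ofHom (algebraMap ℂ ℂ)) = 𝟙 (Spec (.of ℂ)) := by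
  rw [Algebra.algebraMap_self, CommRingCat.ofHom_id]
  exact Spec.map_id _

/-- `Spec ℂ` has exactly one `ℂ`-point over `ℂ` (a `ℂ`-algebra endomorphism of `ℂ` is the identity).
[folklore] -/
private theorem subsingleton_complexPoints_specOver :
    Subsingleton (Motives.ComplexPoints (Motives.specOver ℂ ℂ)) := by
  haveI : IsIso (Motives.specOver ℂ ℂ).hom := by
    change IsIso (Spec.map (CommRingCat.ofHom (algebraMap ℂ ℂ)))
    rw [spec_map_algebraMap_complex_self]
    infer_instance
  refine ⟨fun u v => Over.OverMorphism.ext ?_⟩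
  exact (cancel_mono (Motives.specOver ℂ ℂ).hom).mp ((Over.w u).trans (Over.w v).symm)

/-- Every `ℂ`-point of `Spec ℂ` is an isomorphism on underlying schemes. [folklore] -/
private theorem isIso_left_complexPoint_specOver (s : Motives.ComplexPoints (Motives.specOver ℂ ℂ)) :
    IsIso s.left := by
  haveI := subsingleton_complexPoints_specOver
  rw [Subsingleton.elim s (𝟙 _), Over.id_left]
  infer_instance

/-! ### Fibres over a point whose inclusion is an isomorphism -/

section Fibres

variable {𝒳 S : Motives.SchemeOver ℂ} (π : 𝒳 ⟶ S)

/-- Over a point `s` with `s.left` an isomorphism (e.g. any `ℂ`-point of `Spec ℂ`), the fibre inclusion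
`𝒳_s ⟶ 𝒳` is an isomorphism on underlying schemes (`pullback.fst` of an isomorphism). [folklore] -/
private theorem isIso_fiberι_left (s : Motives.AlgPoints S ℂ) [IsIso s.left] :
    IsIso (Motives.fiberι π s).left := by
  change IsIso (pullback.fst π.left s.left)
  infer_instance

/-- **Pull-back along a pair of mutually inverse continuous maps is bijective on `H^j(−; ℂ)`**
(functoriality: `(g ∘ f)^* = f^* ∘ g^*`, `𝟙^* = 𝟙`). [cite: HatcherAT2002, §3.1 p. 197] -/
theorem bijective_singularCohomology_map_of_inverse {Y Y' : Type} [TopologicalSpace Y]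
    [TopologicalSpace Y'] (f : C(Y, Y')) (g : C(Y', Y)) (hgf : g.comp f = ContinuousMap.id Y)
    (hfg : f.comp g = ContinuousMap.id Y') (j : ℕ) :
    Function.Bijective (singularCohomology.map ℂ ℂ f j) := by
  have h1 : singularCohomology.map ℂ ℂ g j ≫ singularCohomology.map ℂ ℂ f j = 𝟙 _ := by
    rw [← singularCohomology.map_comp, hgf, singularCohomology.map_id]
  have h2 : singularCohomology.map ℂ ℂ f j ≫ singularCohomology.map ℂ ℂ g j = 𝟙 _ := by
    rw [← singularCohomology.map_comp, hfg, singularCohomology.map_id]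
  have hl : Function.LeftInverse (singularCohomology.map ℂ ℂ g j) (singularCohomology.map ℂ ℂ f j) :=
    fun a => by
      change (singularCohomology.map ℂ ℂ f j ≫ singularCohomology.map ℂ ℂ g j) a = a
      rw [h2]
      rfl
  have hr : Function.RightInverse (singularCohomology.map ℂ ℂ g j) (singularCohomology.map ℂ ℂ f j) :=
    fun c => by
      change (singularCohomology.map ℂ ℂ g j ≫ singularCohomology.map ℂ ℂ f j) c = c
      rw [h1]
      rfl
  exact ⟨hl.injective, hr.surjective⟩

/-- **A family over a one-point base is cohomologically locally trivial by restriction** (the degenerate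
case of [VoisinHodgeI2002, §9.2.1]): if `S(ℂ)` is a single point and every fibre inclusion is an isomorphism,
then over `U = S(ℂ)` the tube is `𝒳(ℂ)` and restriction to the fibre `H^j(𝒳(ℂ)) → H^j(𝒳_s(ℂ))` is pull-back
along the homeomorphism `𝒳_s(ℂ) ≅ 𝒳(ℂ)`, hence bijective. [cite: VoisinHodgeI2002, §9.2.1] -/
theorem isCohomologicallyLocallyTrivialOn_univ_of_subsingleton [Subsingleton (Motives.ComplexPoints S)]
    (hι : ∀ s : Motives.ComplexPoints S, IsIso (Motives.fiberι π s).left) :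
    IsCohomologicallyLocallyTrivialOn π Set.univ := by
  refine ⟨fun t _ W hW => ⟨Set.univ, isOpen_univ, Set.mem_univ _, fun x _ => ?_, le_rfl,
    fun j s hs => ?_⟩⟩
  · rw [Subsingleton.elim x t]
    exact mem_of_mem_nhds hW
  · haveI := hι s
    -- the fibre `𝒳_s ≅ 𝒳` as `ℂ`-schemes, forward map the fibre inclusion
    let e : Motives.fiberOver π s ≅ 𝒳 :=
      Over.isoMk (asIso (Motives.fiberι π s).left) (Over.w (Motives.fiberι π s))
    have he : e.hom = Motives.fiberι π s := rfl
    -- the inverse of `fiberToTube`: forget the tube, apply `e⁻¹(ℂ)`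
    let g : C(tubeOver π (Set.univ : Set (Motives.ComplexPoints S)),
        Motives.ComplexPoints (Motives.fiberOver π s)) :=
      (Motives.AlgPoints.mapContinuous (L := ℂ) e.inv).comp ⟨Subtype.val, continuous_subtype_val⟩
    refine bijective_singularCohomology_map_of_inverse (fiberToTube π hs) g ?_ ?_ j
    · refine ContinuousMap.ext fun P => ?_
      change Motives.AlgPoints.map e.inv (Motives.AlgPoints.map (Motives.fiberι π s) P) = P
      rw [← he, Motives.AlgPoints.map_inv_map_hom_apply]
    · refine ContinuousMap.ext fun Q => Subtype.ext ?_
      change Motives.AlgPoints.map (Motives.fiberι π s) (Motives.AlgPoints.map e.inv Q.1) = Q.1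
      rw [← he, Motives.AlgPoints.map_hom_map_inv_apply]

end Fibres

/-! ### The bridge -/

/-- **Pridham 2024 (Cor. 2.25 / Rem. 2.27, at the constant family) ⟹ Buchweitz–Flenner 2003, Thm. 7.3 (smoothness
clause).** Granting the fact `Pridham2024_ISemiregular_liftsOverHodgeLocus_model` (for any Chern character theory
`C`), the fact `BuchweitzFlenner2003_semiregularSheaf_deformationsUnobstructed` holds: for `X` smooth projective over
`ℂ` and a vector bundle `F` on the constant deformation `X_B` whose restriction `j^*F` has injective semiregularity map
`σ`, `F` lifts along every principal small extension `X_B ↪ X_A`. Instantiation (module docstring): the constant family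
`X ⟶ Spec ℂ` is a smooth projective family over the smooth base `Spec ℂ`, its one-point base is cohomologically
locally trivial, and the Hodge-locus hypothesis is AUTOMATIC — `ch_p(j^*F)` is algebraic
(`ChernCharacterBetti.ch_mem_algebraicClasses`), hence of type `(p, p)`
(`isOfHodgeType_of_mem_algebraicClasses_of_isSmoothProjective`), and transport over a point is the identity on
restricted global classes (`transportFun_map_fiberι`). This is [Pridham2024Semiregularity, p. 3 L1–3]: «if the family
`X` is constant over `A` […] the condition `ch_p(ℱ) ∈ F^p` is automatically satisfied and the obstruction `o(ℱ)` always
maps to zero (Remark 2.23)». PROVED; no new fact.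
[cite: Pridham2024Semiregularity, Cor. 2.25; Rem. 2.23; Rem. 2.27; p. 3 L1–3]
[cite: BuchweitzFlenner2003, Thm. 7.3] [cite: VoisinHodgeI2002, §9.2.1 and Prop. 11.20] -/
theorem BuchweitzFlenner2003_semiregularSheaf_deformationsUnobstructed_of_pridham (C : ChernCharacterBetti)
    (h : Pridham2024_ISemiregular_liftsOverHodgeLocus_model) :
    BuchweitzFlenner2003_semiregularSheaf_deformationsUnobstructed := by
  intro X n hX A B _ _ _ _ _ _ f hf hsmall ρ XA XB gA qA hA i qB hB j hj hji _ _ eI F hF hsr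
  -- the constant family `π : X ⟶ Spec ℂ` over the base `Spec ℂ`
  let π : X ⟶ Motives.specOver ℂ ℂ := Over.homMk X.hom (by
    change X.hom ≫ Spec.map (CommRingCat.ofHom (algebraMap ℂ ℂ)) = X.hom
    rw [spec_map_algebraMap_complex_self]
    exact Category.comp_id _)
  haveI hSsub : Subsingleton (Motives.ComplexPoints (Motives.specOver ℂ ℂ)) :=
    subsingleton_complexPoints_specOver
  have hι : ∀ s : Motives.ComplexPoints (Motives.specOver ℂ ℂ), IsIso (Motives.fiberι π s).left :=
    fun s => by
      haveI := isIso_left_complexPoint_specOver s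
      exact isIso_fiberι_left π s
  -- every fibre is `X`, by the fibre inclusion
  have eFib : ∀ s : Motives.ComplexPoints (Motives.specOver ℂ ℂ),
      ∃ e : Motives.fiberOver π s ≅ X, e.hom = Motives.fiberι π s := fun s => by
    haveI := hι s
    exact ⟨Over.isoMk (asIso (Motives.fiberι π s).left) (Over.w (Motives.fiberι π s)), rfl⟩
  have hπ : Motives.IsSmoothProjectiveFamily π n :=
    { smoothOfRelativeDimension := hX.smoothOfRelativeDimension
      isProper := Motives.IsSmoothProjective.isProper_holds hX
      isSmoothProjective := fun s => hX.of_iso (eFib s).choose.symm }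
  have hS : _root_.AlgebraicGeometry.Smooth (Motives.specOver ℂ ℂ).hom := by
    change _root_.AlgebraicGeometry.Smooth (Spec.map (CommRingCat.ofHom (algebraMap ℂ ℂ)))
    rw [spec_map_algebraMap_complex_self]
    infer_instance
  have hU : IsCohomologicallyLocallyTrivialOn π Set.univ :=
    isCohomologicallyLocallyTrivialOn_univ_of_subsingleton π hι
  -- the base point, the model `e : X ≅ X_{s₀}`, the sheaf `E₀ = j^* F`
  let s₀ : (Set.univ : Set (Motives.ComplexPoints (Motives.specOver ℂ ℂ))) :=
    ⟨𝟙 (Motives.specOver ℂ ℂ), Set.mem_univ _⟩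
  obtain ⟨e₀, he₀⟩ := eFib (𝟙 (Motives.specOver ℂ ℂ))
  let e : X ≅ Motives.fiberOver π s₀.1 := e₀.symm
  have heinv : e.inv = Motives.fiberι π s₀.1 := he₀
  let E₀ : X.left.Modules := (Scheme.Modules.pullback j).obj F
  have hE₀ : Motives.IsFiniteLocallyFree E₀ := hF.pullback j
  -- full `σ` injective, in Pridham's indexing `{q | q + 1 ∈ Set.univ}`
  have hsr' : IsISemiregular hE₀ {q | q + 1 ∈ (Set.univ : Set ℕ)} :=
    IsISemiregular.mono hE₀ (fun q _ => Set.mem_univ (q + 1)) hsr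
  -- the Hodge hypothesis is automatic: `ch_p(E₀)` is algebraic, hence `(p, p)`, and transport over a point is trivial
  have hHodge : ∀ p ∈ (Set.univ : Set ℕ),
      ∀ (t : (Set.univ : Set (Motives.ComplexPoints (Motives.specOver ℂ ℂ))))
      (γ : Path.Homotopic.Quotient s₀ t),
      IsOfHodgeType n (Motives.fiberOver π t.1) (2 * p) p p
        (transportFun π (2 * p) hU γ (complexBetti.map e.inv (2 * p) (C.ch X E₀ p))) := by
    intro p _ t γ
    rw [heinv, transportFun_map_fiberι]
    obtain ⟨et, het⟩ := eFib t.1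
    rw [← het, isOfHodgeType_map_iff_of_iso]
    exact isOfHodgeType_of_mem_algebraicClasses_of_isSmoothProjective hX p
      (C.ch_mem_algebraicClasses hX E₀ hE₀.isVectorBundle p)
  -- the Artinian point `a : Spec A → Spec ℂ`, centred at `s₀`
  let a : Motives.specOver ℂ A ⟶ Motives.specOver ℂ ℂ :=
    Over.homMk (Spec.map (CommRingCat.ofHom (algebraMap ℂ A))) (by
      change Spec.map (CommRingCat.ofHom (algebraMap ℂ A)) ≫
          Spec.map (CommRingCat.ofHom (algebraMap ℂ ℂ)) = Spec.map (CommRingCat.ofHom (algebraMap ℂ A))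
      rw [spec_map_algebraMap_complex_self]
      exact Category.comp_id _)
  have ha : Spec.map (CommRingCat.ofHom (ρ.comp f).toRingHom) ≫ a.left = s₀.1.left := by
    change Spec.map (CommRingCat.ofHom (ρ.comp f).toRingHom) ≫
        Spec.map (CommRingCat.ofHom (algebraMap ℂ A)) = 𝟙 (Spec (.of ℂ))
    rw [← Spec.map_comp, ← CommRingCat.ofHom_comp]
    have hcomp : (ρ.comp f).toRingHom.comp (algebraMap ℂ A) = algebraMap ℂ ℂ :=
      RingHom.ext fun x => (ρ.comp f).commutes x
    rw [hcomp]
    exact spec_map_algebraMap_complex_self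
  -- the closed fibre of the telescope is compatible with the model: `j ≫ i ≫ gA = 𝟙 = e.hom ≫ fiberι`
  have hje : j ≫ i ≫ gA = e.hom.left ≫ (Motives.fiberι π s₀.1).left := by
    rw [hji, ← heinv, ← Over.comp_left, e.hom_inv_id, Over.id_left]
  exact h C π n hπ hS hU s₀ X e E₀ hE₀ Set.univ hsr' hHodge A B f hf hsmall ρ a ha gA qA hA i qB hB j hj
    hje F hF.isVectorBundle ⟨Iso.refl _⟩

end Literature.AlgebraicGeometry.HodgeTheory

end
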